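import Summits.QuantumFields.YangMills.Theorems.BalabanUVNodesN15TwoGridDressedLaplacianSupCarrierFullG
import Summits.QuantumFields.YangMills.Theorems.BalabanUVNodesN15SizedKnitSocket
import HarnessLib

/-!
# N15 (NE2) — PROGRAMME Λ, part Λ-D: `N15At` AND THE K3⁸ GUARD FOR THE PAIR OF RECORD WITH ALL FOUR (3.42) OPERATOR ENTRIES BACKGROUND-LIVE —
# ONE application of the sized knit socket (S-D `n15At_opGeoS_of_ne2PlusOperator`, `live_opGeoS`) to Λ-C's ★★★ `ne2PlusOperator_allEntries_fullG`; the `NE2Objects₁₁` literal and the keyed-home face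

WHO ∕ WHEN.  Cell `pub-ymgap`, seat `pub-ymgap-dag-n15-a` (KNIT-BY-NAME seat of Track-A DAG node N15 = NE2, g27); `--supports stmt-QuantumFields-27366 --as helper` (K3⁸; count-neutral).
One plumbing `def` (§3 literal) + theorems.  Over Λ-C `…TwoGridDressedLaplacianSupCarrierFullG` (def `foFamilyAllFG`, ★★★ `ne2PlusOperator_allEntries_fullG`), II-E (`foInstanceFG`, `coeffBgFO`,
`reg335_coeffBgFO_iff`), S-D `…N15SizedKnitSocket` (`geoS`, `siteOnS`, `covOnS`, `n15At_opGeoS_of_ne2PlusOperator`, `live_opGeoS`, `s_N15_of_admits`), part 82 (`TGIndexS`, `tgIndexS_cofinal`),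
dag-n15-w2's `PairedFamilyGuard.Live`, RR-1's `NE2Objects₁₁`, the dagwriter's `N15At` BY NAME; nothing in the tree is modified.  PATTERN = g23's `…TwoSpacingGluingNeumannKnitN15At` (the same
socket applied to dag-n15-c's glued knit family).

WHAT.  II-E's sized first-order family `foInstanceFG d hL : TGIndexS → PairedInstance` IS the socket's literal at `ι := toTGIndex`, `Mc := Msz`, arguments = real 1-forms blocked by
`blkFine`, fine geometry ∕ both background carriers ∕ pairing = II-E's (§1 `foInstanceFG_eq_opGeoS`, `rfl`), so:
* §1 ★★★ `n15At_allEntries_fullG` — `N15At ⟨TGIndexS, c₃₅, p, foInstanceFG, foFamilyAllFG a ν κ, siteOnS a_S …, covOnS α β …, ⊤, dist⟩` OUTRIGHT (`d ≥ 1`, odd `L ≥ 3`, `a, a_S, c₃₅ > 0`;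
  every `p`, directions `ν κ α β`): OPERATOR = Λ-C (Bałaban's pair `(Δ′_a⁻¹, Δ_a⁻¹)` dressed by the first-order species, ALL FOUR ENTRIES BACKGROUND-LIVE under the (3.35) pair alone),
  SITE = G1's genuine `(Q′G′²Q′*)⁻¹` kernel, UNIT = [B6] (2.156) `C^{(k)}_Λ` — both `U ≡ 1` kernels re-based on the coefficient carrier `coeffBgFO` (their «+» idle, said);
* §2 `reg_zero_foInstanceFG` (the trivial coefficient field `0` is (3.35)∕(3.36)-regular at every `α₀ > 0`, `c₃₅ ≥ 0`), ★★ `live_foInstanceFG` (ANY kernels: size `M_sz` and scale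
  count `k` jointly cofinal — `tgIndexS_cofinal`), ★★★ `live_and_n15At_allEntries_fullG` (the pair the K3⁸ guard + rates holder read);
* §3 def `allEntriesObjects` (the family as RR-1's `NE2Objects₁₁` literal), `ne2OfRecord₁₁_allEntriesObjects` (`rfl`), `n15At_allEntriesObjects`, `live_allEntriesObjects`, ★★
  `s_N15_of_admits_allEntries` (part 30's stage-generic keyed home: any reading pinned to the literal has `S_N15`).

HONEST FRAMING ∕ LIMITS.  By-name composition; no estimate proved here.  The OPERATOR layer carries the configuration genuinely in all four (3.42) entries — IN THE ABELIANISED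
SCALAR-MULTIPLIER MODEL of (3.52)'s `V′(A)` with block-averaged coarse partner (C3) («covariant Laplacian» := `Δ − V₁`, «covariant divergence» := flat `∇*_κ`; Bałaban's `Δ_U`, `D*_U` of
(3.50) differ by the non-abelian dressing — n15-c's lane, located); site ∕ unit layers are the `U ≡ 1` kernels (U-blind); Bałaban's size `M` is live through the (3.35) letters `c₃₅·M·α₀`.
`U ≡ 1` Landau-gauge pair on the torus family of record, NOT [B9]'s `G(U)` for general `U`; NE2⁺ as printed NOT PRINTED ∕ NOT proved; no statement of record touched; N15 NOT discharged; K3⁸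
OPEN, skeleton untouched; counts of record UNMOVED (typed 28∕28 · discharged 6∕28); one finite 𝕋⁴ at fixed ε per index — NOT infinite volume, NOT OS on ℝ⁴, NOT a mass gap, NOT Clay.
One plumbing `def` (§3 literal) ⇒ review ∕ audit lane.
-/

noncomputable section

namespace Summit.QuantumFields.YangMills.BalabanUVNodes.N15.GenuineRecord

open Literature.MathematicalPhysics.QuantumFieldTheory.Balaban1983to89
open Literature.MathematicalPhysics.QuantumFieldTheory.Balaban1983to89.T4Continuum (T4Family ULoop)
open Literature.MathematicalPhysics.QuantumFieldTheory.Balaban1983to89.T4EtaRate (EtaPairing PairedInstance NE2PlusOperator NE2PlusSite NE2PlusUnit)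
open Literature.MathematicalPhysics.QuantumFieldTheory.Balaban1983to89.B5Prop11Plancherel (Tor fine)
open Node00 (NE2Objects₁₁)
open Summit.QuantumFields.YangMills.BalabanUVNodes.N15.OperatorReadout (opGeo)
open Summit.QuantumFields.YangMills.BalabanUVNodes.N15.TwoGrid (TGIndex coeffBgFO reg335_coeffBgFO_iff foInstanceFG foFamilyAllFG ne2PlusOperator_allEntries_fullG)
open Summit.QuantumFields.YangMills.BalabanUVNodes.N15.BackgroundLayer (fgrad fgrad_apply)
open Summit.QuantumFields.YangMills.BalabanUVNodes.N15.VectorPiece (blkFine)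
open Summit.QuantumFields.YangMills.BalabanUVNodes.N15.AtKeyedHome (s_N15_of_admits)
open Summit.QuantumFields.YangMills.BalabanUVNodes.N15.PairedFamilyGuard (Live)
open YMDAG.UVSplit (Datum NE2Carriers RateCarriers RateRecordPred N15At S_N15 ne2OfRecord₁₁)

variable {d : ℕ} {L : ℕ} [NeZero L]

/-! ## §1 II-E's sized first-order family is an instance of the sized socket; `N15At` outright -/

/-- THE FIRST-ORDER SIZED INSTANCE IS THE SOCKET's LITERAL at `ι = toTGIndex`, `Mc = M_sz` (`rfl`). [bookkeeping] -/
theorem foInstanceFG_eq_opGeoS (hL : Odd L ∧ 1 < L) :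
    foInstanceFG d hL = fun j =>
      (⟨opGeo (geoS d hL TGIndexS.toTGIndex TGIndexS.Msz j) (Tor (fine (L ^ j.k) (TGIndex.Mn d hL j.toTGIndex)) × Fin (d + 1)) (blkFine L j.k (TGIndex.Mn d hL j.toTGIndex)),
        (foInstanceFG d hL j).gf, (foInstanceFG d hL j).Bc, (foInstanceFG d hL j).Bf, (foInstanceFG d hL j).pair⟩ : PairedInstance) := rfl

/-- ★★★ **`N15At` FOR THE PAIR OF RECORD WITH ALL FOUR OPERATOR ENTRIES BACKGROUND-LIVE, OUTRIGHT** (`d ≥ 1`, odd `L ≥ 3`, `a, a_S, c₃₅ > 0`; every `p`, directions `ν κ α β`): OPERATOR =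
Λ-C `ne2PlusOperator_allEntries_fullG` (Bałaban's `(Δ′_a⁻¹, Δ_a⁻¹)` dressed by the first-order species on the (3.35)-pair carrier; value, gradient, source divergence, covariant Laplacian
live), SITE = G1's genuine `(Q′G′²Q′*)⁻¹` kernel, UNIT = [B6] (2.156) `C^{(k)}_Λ`, through the sized socket S-D. [bookkeeping] -/
theorem n15At_allEntries_fullG (hd : 1 ≤ d) (hLodd : Odd L) (hL3 : 3 ≤ L) (hL : Odd L ∧ 1 < L) {a aS c35 : ℝ} (ha : 0 < a) (haS : 0 < aS) (hc35 : 0 < c35)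
    (ν κ α β : Fin (d + 1)) (p : ℝ) :
    N15At { I := TGIndexS, c35 := c35, p := p, pi := foInstanceFG d hL, Kop := foFamilyAllFG d hL a ν κ,
            Ksite := siteOnS d hL aS TGIndexS.toTGIndex TGIndexS.Msz (fun j => Tor (fine (L ^ j.k) (TGIndex.Mn d hL j.toTGIndex)) × Fin (d + 1))
              (fun j => blkFine L j.k (TGIndex.Mn d hL j.toTGIndex)) (fun j => (foInstanceFG d hL j).Bf),
            Kunit := covOnS d hL α β TGIndexS.toTGIndex TGIndexS.Msz (fun j => Tor (fine (L ^ j.k) (TGIndex.Mn d hL j.toTGIndex)) × Fin (d + 1))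
              (fun j => blkFine L j.k (TGIndex.Mn d hL j.toTGIndex)) (fun j => (foInstanceFG d hL j).Bf),
            inΛ := fun _ _ => True, unitDist := fun j => (foInstanceFG d hL j).gc.dist } :=
  n15At_opGeoS_of_ne2PlusOperator (d := d) hL TGIndexS.toTGIndex TGIndexS.Msz (fun j => Tor (fine (L ^ j.k) (TGIndex.Mn d hL j.toTGIndex)) × Fin (d + 1))
    (fun j => blkFine L j.k (TGIndex.Mn d hL j.toTGIndex)) (fun j => (foInstanceFG d hL j).gf) (fun j => (foInstanceFG d hL j).Bc) (fun j => (foInstanceFG d hL j).Bf)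
    hd hLodd (by omega) haS α β (fun j => j.one_le_mT) (fun j => (foInstanceFG d hL j).pair) p (foFamilyAllFG d hL a ν κ)
    (ne2PlusOperator_allEntries_fullG d hLodd hL3 hL ha c35 hc35 ν κ)

/-! ## §2 The family passes the guard; guard ∧ estimate together -/

/-- the trivial coefficient field `0` of the fine first-order carrier `coeffBgFO` is (3.35)∕(3.36)-regular at every `α₀ > 0` (`c₃₅ ≥ 0`; sups and first quotients of `0` vanish). [folklore] -/
theorem reg_zero_foInstanceFG (hL : Odd L ∧ 1 < L) {c35 : ℝ} (hc35 : 0 ≤ c35) (j : TGIndexS) {α₀ : ℝ} (hα₀ : 0 < α₀) :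
    (foInstanceFG d hL j).Bf.Reg335 c35 α₀ (foInstanceFG d hL j).Bf.one ∧ (foInstanceFG d hL j).Bf.Reg336 c35 α₀ (foInstanceFG d hL j).Bf.one := by
  have hM : (0 : ℝ) ≤ j.Msz := zero_le_one.trans j.one_le_Msz
  have h0 : (0 : ℝ) ≤ c35 * j.Msz * α₀ := mul_nonneg (mul_nonneg hc35 hM) hα₀.le
  have h335 : (coeffBgFO (TGIndex.Mn d hL j.toTGIndex) (L ^ j.m * L ^ j.k) j.Msz).Reg335 c35 α₀ (coeffBgFO (TGIndex.Mn d hL j.toTGIndex) (L ^ j.m * L ^ j.k) j.Msz).one := by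
    refine (reg335_coeffBgFO_iff (TGIndex.Mn d hL j.toTGIndex) (L ^ j.m * L ^ j.k) j.Msz c35 α₀ _).2 ⟨fun z => ?_, fun μ' z => ?_, fun μ' κ' z => ?_⟩
    · show |(0 : ℝ)| ≤ _; rw [abs_zero]; exact h0
    · show |(0 : ℝ)| ≤ _; rw [abs_zero]; exact h0
    · rw [fgrad_apply]
      show |((L ^ j.m * L ^ j.k : ℕ) : ℝ) * ((0 : ℝ) - 0)| ≤ _
      rw [sub_zero, mul_zero, abs_zero]; exact h0
  exact ⟨h335, h335⟩

/-- ★★ **THE FIRST-ORDER SIZED FAMILY PASSES THE K3⁷∕K3⁸ GUARD** (dag-n15-w2's `Live` BY NAME) for ANY kernels: size `M_sz` and scale count `k` jointly cofinal (`tgIndexS_cofinal`), the trivial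
field regular, the region `⊤` met (`c₃₅ ≥ 0`). [bookkeeping] -/
theorem live_foInstanceFG (hL : Odd L ∧ 1 < L) {c35 : ℝ} (hc35 : 0 ≤ c35) (p : ℝ)
    (Kop : ∀ j, B9.KernelFamily (foInstanceFG d hL j).gc (foInstanceFG d hL j).Bf) (Ksite Kunit : ∀ j, B9.SiteKernel (foInstanceFG d hL j).gc (foInstanceFG d hL j).Bf) :
    Live ⟨TGIndexS, c35, p, foInstanceFG d hL, Kop, Ksite, Kunit, fun _ _ => True, fun j => (foInstanceFG d hL j).gc.dist⟩ :=
  live_opGeoS (d := d) hL TGIndexS.toTGIndex TGIndexS.Msz (fun j => Tor (fine (L ^ j.k) (TGIndex.Mn d hL j.toTGIndex)) × Fin (d + 1))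
    (fun j => blkFine L j.k (TGIndex.Mn d hL j.toTGIndex)) (fun j => (foInstanceFG d hL j).gf) (fun j => (foInstanceFG d hL j).Bc) (fun j => (foInstanceFG d hL j).Bf)
    (fun j => (foInstanceFG d hL j).pair) c35 p Kop Ksite Kunit tgIndexS_cofinal (fun j _ hα₀ => reg_zero_foInstanceFG hL hc35 j hα₀)

/-- ★★★ **GUARD ∧ `N15At` FOR THE PAIR OF RECORD WITH ALL FOUR OPERATOR ENTRIES BACKGROUND-LIVE** (`d ≥ 1`, odd `L ≥ 3`, `a, a_S, c₃₅ > 0`). [bookkeeping] -/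
theorem live_and_n15At_allEntries_fullG (hd : 1 ≤ d) (hLodd : Odd L) (hL3 : 3 ≤ L) (hL : Odd L ∧ 1 < L) {a aS c35 : ℝ} (ha : 0 < a) (haS : 0 < aS) (hc35 : 0 < c35)
    (ν κ α β : Fin (d + 1)) (p : ℝ) :
    Live ⟨TGIndexS, c35, p, foInstanceFG d hL, foFamilyAllFG d hL a ν κ,
        siteOnS d hL aS TGIndexS.toTGIndex TGIndexS.Msz (fun j => Tor (fine (L ^ j.k) (TGIndex.Mn d hL j.toTGIndex)) × Fin (d + 1))
          (fun j => blkFine L j.k (TGIndex.Mn d hL j.toTGIndex)) (fun j => (foInstanceFG d hL j).Bf),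
        covOnS d hL α β TGIndexS.toTGIndex TGIndexS.Msz (fun j => Tor (fine (L ^ j.k) (TGIndex.Mn d hL j.toTGIndex)) × Fin (d + 1))
          (fun j => blkFine L j.k (TGIndex.Mn d hL j.toTGIndex)) (fun j => (foInstanceFG d hL j).Bf), fun _ _ => True,
        fun j => (foInstanceFG d hL j).gc.dist⟩ ∧
      N15At { I := TGIndexS, c35 := c35, p := p, pi := foInstanceFG d hL, Kop := foFamilyAllFG d hL a ν κ,
              Ksite := siteOnS d hL aS TGIndexS.toTGIndex TGIndexS.Msz (fun j => Tor (fine (L ^ j.k) (TGIndex.Mn d hL j.toTGIndex)) × Fin (d + 1))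
                (fun j => blkFine L j.k (TGIndex.Mn d hL j.toTGIndex)) (fun j => (foInstanceFG d hL j).Bf),
              Kunit := covOnS d hL α β TGIndexS.toTGIndex TGIndexS.Msz (fun j => Tor (fine (L ^ j.k) (TGIndex.Mn d hL j.toTGIndex)) × Fin (d + 1))
                (fun j => blkFine L j.k (TGIndex.Mn d hL j.toTGIndex)) (fun j => (foInstanceFG d hL j).Bf),
              inΛ := fun _ _ => True, unitDist := fun j => (foInstanceFG d hL j).gc.dist } :=
  ⟨live_foInstanceFG hL hc35.le p _ _ _, n15At_allEntries_fullG hd hLodd hL3 hL ha haS hc35 ν κ α β p⟩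

/-! ## §3 The family as an `NE2Objects₁₁` literal; the keyed-home face -/

/-- THE ALL-ENTRIES-LIVE PAIR-OF-RECORD FAMILY AS RR-1's NE2 OBJECT LITERAL (`NE2Objects₁₁`), field for field. [bookkeeping] -/
def allEntriesObjects (d : ℕ) (hL : Odd L ∧ 1 < L) (a aS : ℝ) (ν κ α β : Fin (d + 1)) (c35 p : ℝ) : NE2Objects₁₁ :=
  ⟨TGIndexS, c35, p, foInstanceFG d hL, foFamilyAllFG d hL a ν κ,
    siteOnS d hL aS TGIndexS.toTGIndex TGIndexS.Msz (fun j => Tor (fine (L ^ j.k) (TGIndex.Mn d hL j.toTGIndex)) × Fin (d + 1))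
      (fun j => blkFine L j.k (TGIndex.Mn d hL j.toTGIndex)) (fun j => (foInstanceFG d hL j).Bf),
    covOnS d hL α β TGIndexS.toTGIndex TGIndexS.Msz (fun j => Tor (fine (L ^ j.k) (TGIndex.Mn d hL j.toTGIndex)) × Fin (d + 1))
      (fun j => blkFine L j.k (TGIndex.Mn d hL j.toTGIndex)) (fun j => (foInstanceFG d hL j).Bf), fun _ _ => True,
    fun j => (foInstanceFG d hL j).gc.dist⟩

/-- the record map reads the literal as the rates bundle (`rfl`). [bookkeeping] -/
theorem ne2OfRecord₁₁_allEntriesObjects (hL : Odd L ∧ 1 < L) (a aS : ℝ) (ν κ α β : Fin (d + 1)) (c35 p : ℝ) :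
    ne2OfRecord₁₁ (allEntriesObjects d hL a aS ν κ α β c35 p) =
      { I := TGIndexS, c35 := c35, p := p, pi := foInstanceFG d hL, Kop := foFamilyAllFG d hL a ν κ,
        Ksite := siteOnS d hL aS TGIndexS.toTGIndex TGIndexS.Msz (fun j => Tor (fine (L ^ j.k) (TGIndex.Mn d hL j.toTGIndex)) × Fin (d + 1))
          (fun j => blkFine L j.k (TGIndex.Mn d hL j.toTGIndex)) (fun j => (foInstanceFG d hL j).Bf),
        Kunit := covOnS d hL α β TGIndexS.toTGIndex TGIndexS.Msz (fun j => Tor (fine (L ^ j.k) (TGIndex.Mn d hL j.toTGIndex)) × Fin (d + 1))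
          (fun j => blkFine L j.k (TGIndex.Mn d hL j.toTGIndex)) (fun j => (foInstanceFG d hL j).Bf),
        inΛ := fun _ _ => True, unitDist := fun j => (foInstanceFG d hL j).gc.dist } := rfl

/-- ★★ `N15At` at the literal (`d ≥ 1`, odd `L ≥ 3`, `a, a_S, c₃₅ > 0`). [bookkeeping] -/
theorem n15At_allEntriesObjects (hd : 1 ≤ d) (hLodd : Odd L) (hL3 : 3 ≤ L) (hL : Odd L ∧ 1 < L) {a aS c35 : ℝ} (ha : 0 < a) (haS : 0 < aS) (hc35 : 0 < c35)
    (ν κ α β : Fin (d + 1)) (p : ℝ) :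
    N15At (ne2OfRecord₁₁ (allEntriesObjects d hL a aS ν κ α β c35 p)) :=
  n15At_allEntries_fullG hd hLodd hL3 hL ha haS hc35 ν κ α β p

/-- ★★ the literal is LIVE (`c₃₅ ≥ 0`). [bookkeeping] -/
theorem live_allEntriesObjects (hL : Odd L ∧ 1 < L) (a aS : ℝ) (ν κ α β : Fin (d + 1)) {c35 : ℝ} (hc35 : 0 ≤ c35) (p : ℝ) :
    Live (ne2OfRecord₁₁ (allEntriesObjects d hL a aS ν κ α β c35 p)) :=
  live_foInstanceFG hL hc35 p _ _ _

variable {N : ℕ} [NeZero N] {key : (F : T4Family) → Datum F N → Prop}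

/-- ★★ **THE ALL-ENTRIES-LIVE FAMILY AT ANY KEYED HOME** (part 30's interface): a rate home over ANY key admitting only the literals of a key-indexed NE2 reading whose value everywhere is
this family has `S_N15 RRec` (`d ≥ 1`, odd `L ≥ 3`, `a, a_S, c₃₅ > 0`). [bookkeeping] -/
theorem s_N15_of_admits_allEntries (hd : 1 ≤ d) (hLodd : Odd L) (hL3 : 3 ≤ L) (hL : Odd L ∧ 1 < L) {a aS c35 : ℝ} (ha : 0 < a) (haS : 0 < aS) (hc35 : 0 < c35)
    (ν κ α β : Fin (d + 1)) (p : ℝ) (ne2At : ∀ {F : T4Family} {D : Datum F N}, key F D → (ℕ → ℝ) → List (ULoop F) → ℕ → NE2Objects₁₁) (RRec : RateRecordPred N)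
    (hadm : ∀ (F : T4Family) (D : Datum F N) (g₀ : ℕ → ℝ) (os : List (ULoop F)) (R : RateCarriers N), RRec F D g₀ os R →
      ∃ (h : key F D) (k : ℕ), R.ne2 = ne2OfRecord₁₁ (ne2At h g₀ os k))
    (h : ∀ (F : T4Family) (D : Datum F N) (h : key F D) (g₀ : ℕ → ℝ) (os : List (ULoop F)) (k : ℕ), ne2At h g₀ os k = allEntriesObjects d hL a aS ν κ α β c35 p) :
    S_N15 RRec :=
  s_N15_of_admits ne2At RRec hadm fun F D hk g₀ os k => by rw [h F D hk g₀ os k]; exact n15At_allEntriesObjects hd hLodd hL3 hL ha haS hc35 ν κ α β p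

end Summit.QuantumFields.YangMills.BalabanUVNodes.N15.GenuineRecord

end
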